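import Summits.QuantumAdvantage.QuantumAdvantage.Theorems.FlatDialTables

/-!
# FlatDialEasyFlat — module 14 of the lens-3 g11 «FlatDial» THEOREMS package (cell decomp-qadv): the planted family has an EASY FLAT — the ceiling of the recovery method

Record §14.  Modules 5–13 decide `W_M` (`no_mfinder`: no `AC⁰[⊕]` finder of `M`-SUBSPACE certificates) by the recovery schema: every valid
`M`-certificate of the planted function `G_w = cubeMM (m+1) ∘ A_w` leaks `MOD₃(w)`.  This module proves that the same schema CANNOT decide the
node's crux `W` (= `FlatSearchHard`, certificates = arbitrary affine half-flats) with this family — a kernel-checked CEILING: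

* `easyCert m` : a CONSTANT (seed-independent) flat certificate — offset `0`, slope `0`, rows `e′_{a₀}` and `e″_j (j ≠ a₀)` — spanning the
  half-flat `P = {y : y′ = λ·e_{a₀}, y″(a₀) = 0}`; since row `a₀` of the counter matrix `N_w` is the unit row (`QQ_a₀`: the END node has no
  outgoing edge), `A_w P ⊆ {x = 0}` where `cubeMM ≡ 0` (`frame_comb_easy_x`);
* ★ `easyCert_mem_validCerts` : `easyCert m ∈ validCerts G_w` for EVERY seed `w`;
* ★★ `no_flatExtractor` : hence NO composition-closed `AC⁰[⊕]` extractor `E` satisfies `E_w(c) = MOD₃(w)` for all valid flat certificates `c`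
  of `G_w` (it would compute `MOD₃` from the constant `easyCert`; Smolensky) — the `FlatRecovery`-type schema of module 3 has no instance whose
  planted family is the g11 family.  `W` needs a planted family WITHOUT easy flats (record §14.3: a rigid / unique-flat signed cubic dual).

ZERO `def X : Prop`.  Provenance: HOME/decomp-qadv-lens-3/g11/ (record NODE-g11.md §14, LAND-g11.md step 14).
-/

set_option linter.dupNamespace false

namespace Summit.QuantumAdvantage.QuantumAdvantage.Theorems.FlatDial

open Finset
open Literature.Computability.Complexity
open Literature.Computability.QuantumComplexity
open Literature.Computability.MetaComplexity
open Literature.Computability.QuantumComplexity.BuzetChailloux (bxor zeroVec bxor_self bxor_zeroVec zeroVec_bxor)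
open Summit.QuantumAdvantage.QuantumAdvantage.Theorems.HintDial.Automaton (bd sgl bd_sgl_left bd_sgl_right kk nd Nd a₀ QQ IsLit
  edgeB edgeB_zero bd_zeroVec_right)

section Easy

variable {m : ℕ}

/-! ## 1. Row `a₀` of the counter matrix is the unit row -/

/-- the END node `(0,0)` has no outgoing edge: `(N_w)_{a₀ •} = e_{a₀}`. -/
theorem QQ_a₀ (w : Fin m → Bool) : QQ w a₀ = sgl (a₀ : Fin (kk m)) := by
  funext b
  show xor (decide (nd.symm a₀ = nd.symm b)) (edgeB w (nd.symm a₀) (nd.symm b)) = decide (b = a₀)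
  rw [show nd.symm (a₀ : Fin (kk m)) = (((0 : Fin (m + 1)), (0 : Fin 3)) : Nd m) by rw [a₀, Equiv.symm_apply_apply],
    edgeB_zero, Bool.xor_false]
  by_cases h : b = a₀
  · rw [decide_eq_true h, h, a₀, Equiv.symm_apply_apply]; exact decide_eq_true rfl
  · rw [decide_eq_false h]
    exact decide_eq_false fun e => h (by rw [a₀, e, Equiv.apply_symm_apply])

/-- `cubeMM` vanishes when the `x`-half does. -/
theorem cubeMM_of_x {r : ℕ} {y : Fin (r * 3 + r * 3) → Bool} (hy : ∀ j, y (Fin.castAdd (r * 3) j) = false) :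
    cubeMM r y = false := by
  rw [cubeMM_eq_bd, show (fun j => y (Fin.castAdd (r * 3) j)) = zeroVec from funext hy, bd_zeroVec_left]

/-! ## 2. The easy certificate -/

/-- row `j`: `e′_{a₀}` for `j = a₀`, else `e″_j`. -/
def erow (j : Fin (kk m)) : Fin (kk m + kk m) → Bool :=
  if j = a₀ then Fin.append (sgl a₀) zeroVec else Fin.append zeroVec (sgl j)

/-- ★ THE EASY FLAT CERTIFICATE (independent of the seed): offset `0`, slope `0`, rows `erow`. -/
def easyCert (m : ℕ) : CertIdx (kk m + kk m) → Bool :=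
  Sum.elim (fun _ => false) (Sum.elim (fun ki => erow (Fin.cast (half_rows (m + 1)) ki.1) ki.2) fun _ => false)

/-- its offset is `0`. -/
theorem certT_easyCert : certT (easyCert m) = zeroVec := rfl

/-- its slope is `0`. -/
theorem certXs_easyCert : certXs (easyCert m) = zeroVec := rfl

/-- its rows. -/
theorem certRow_easyCert (k : Fin ((kk m + kk m) / 2)) : certRow (easyCert m) k = erow (Fin.cast (half_rows (m + 1)) k) := rfl

/-- `x`-coordinates of a row. -/
theorem erow_x (j a : Fin (kk m)) : erow j (Fin.castAdd (kk m) a) = (decide (j = a₀) && decide (a = a₀)) := by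
  unfold erow
  split_ifs with h
  · rw [Fin.append_left, decide_eq_true h, Bool.true_and]; rfl
  · rw [Fin.append_left, decide_eq_false h, Bool.false_and]; rfl

/-- `z`-coordinates of a row. -/
theorem erow_z (j b : Fin (kk m)) : erow j (Fin.natAdd (kk m) b) = (!decide (j = a₀) && decide (b = j)) := by
  unfold erow
  split_ifs with h
  · rw [Fin.append_right, decide_eq_true h]; rfl
  · rw [Fin.append_right, decide_eq_false h]; rfl

/-- the pivot coordinate of row `k`. -/
def pivot (k : Fin ((kk m + kk m) / 2)) : Fin (kk m + kk m) :=
  if Fin.cast (half_rows (m + 1)) k = a₀ then Fin.castAdd (kk m) a₀ else Fin.natAdd (kk m) (Fin.cast (half_rows (m + 1)) k)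

/-- a row combination shows its coefficients at the pivots. -/
theorem comb_easyCert_pivot (a : Fin ((kk m + kk m) / 2) → Bool) (k : Fin ((kk m + kk m) / 2)) :
    comb (easyCert m) a (pivot k) = a k := by
  have hs : (fun k' => certRow (easyCert m) k' (pivot k)) = sgl k := by
    funext k'
    rw [certRow_easyCert, pivot]
    show erow (Fin.cast (half_rows (m + 1)) k') _ = decide (k' = k)
    split_ifs with h
    · rw [erow_x, ← h, decide_eq_true rfl, Bool.and_true]
      by_cases e : k' = k
      · rw [e, decide_eq_true rfl, decide_eq_true rfl]
      · rw [decide_eq_false e, decide_eq_false fun e' => e (Fin.cast_injective _ e')]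
    · rw [erow_z]
      by_cases e : k' = k
      · rw [e, decide_eq_false h, decide_eq_true rfl, decide_eq_true rfl]; rfl
      · rw [decide_eq_false e, decide_eq_false fun e' => e (Fin.cast_injective _ e').symm, Bool.and_false]
  show bd a (fun k' => certRow (easyCert m) k' (pivot k)) = a k
  rw [hs, bd_sgl_right]

/-- ★ the rows of `easyCert m` are independent. -/
theorem comb_easyCert_injective : Function.Injective (comb (easyCert m)) := by
  intro a a' h
  funext k
  rw [← comb_easyCert_pivot a k, ← comb_easyCert_pivot a' k, h]

/-- a row combination vanishes at `z`-coordinate `a₀`. -/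
theorem comb_easyCert_z_a₀ (a : Fin ((kk m + kk m) / 2) → Bool) : comb (easyCert m) a (Fin.natAdd (kk m) a₀) = false := by
  have hs : (fun k' => certRow (easyCert m) k' (Fin.natAdd (kk m) a₀)) = zeroVec := by
    funext k'
    rw [certRow_easyCert, erow_z]
    show (!decide (Fin.cast (half_rows (m + 1)) k' = a₀) && decide (a₀ = Fin.cast (half_rows (m + 1)) k')) = false
    by_cases e : Fin.cast (half_rows (m + 1)) k' = a₀
    · rw [decide_eq_true e]; rfl
    · rw [decide_eq_false e, decide_eq_false fun e' => e e'.symm]; rfl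
  show bd a (fun k' => certRow (easyCert m) k' (Fin.natAdd (kk m) a₀)) = false
  rw [hs, bd_zeroVec_right]

/-- a row combination vanishes at every `x`-coordinate except `a₀`. -/
theorem comb_easyCert_x (a : Fin ((kk m + kk m) / 2) → Bool) {a' : Fin (kk m)} (ha' : a' ≠ a₀) :
    comb (easyCert m) a (Fin.castAdd (kk m) a') = false := by
  have hs : (fun k' => certRow (easyCert m) k' (Fin.castAdd (kk m) a')) = zeroVec := by
    funext k'
    rw [certRow_easyCert, erow_x, decide_eq_false ha', Bool.and_false]; rfl
  show bd a (fun k' => certRow (easyCert m) k' (Fin.castAdd (kk m) a')) = false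
  rw [hs, bd_zeroVec_right]

/-- ★ THE FRAME MAPS THE EASY FLAT INTO `{x = 0}` (row `a₀` of `N_w` is the unit row). -/
theorem frame_comb_easy_x (w : Fin m → Bool) (a : Fin ((kk m + kk m) / 2) → Bool) (a' : Fin (kk m)) :
    frameA w (comb (easyCert m) a) (Fin.castAdd (kk m) a') = false := by
  rw [frameA_x]
  split_ifs with h
  · rw [QQ_a₀, bd_sgl_left]; exact comb_easyCert_z_a₀ a
  · exact comb_easyCert_x a h

/-- ★★ `easyCert m` IS A VALID FLAT CERTIFICATE of the planted function, for EVERY seed. -/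
theorem easyCert_mem_validCerts (w : Fin m → Bool) : easyCert m ∈ validCerts fun y => cubeMM (m + 1) (frameA w y) := by
  refine ⟨comb_easyCert_injective, fun a => ?_⟩
  change cubeMM (m + 1) (frameA w (bxor (certT (easyCert m)) (comb (easyCert m) a)))
      = xor (cubeMM (m + 1) (frameA w (certT (easyCert m)))) (bd (certXs (easyCert m)) (comb (easyCert m) a))
  rw [certT_easyCert, certXs_easyCert, zeroVec_bxor, bd_zeroVec_left, Bool.xor_false, cubeMM_of_x (frame_comb_easy_x w a),
    frame_zeroVec (frameA_bxor w)]
  exact (cubeMM_of_x fun _ => rfl).symm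

/-! ## 3. ★★ No flat-certificate extractor for the planted family -/

/-- ★★ THE CEILING OF THE RECOVERY METHOD: no composition-closed `AC⁰[⊕]` extractor reads `MOD₃(w)` off EVERY valid flat certificate of
`G_w = cubeMM (m+1) ∘ A_w` — because `easyCert m` is valid and constant (Smolensky).  Contrast `mRecovery.recover` (module 13) for
`M`-certificates. -/
theorem no_flatExtractor (E : (m : ℕ) → (Fin m → Bool) → (CertIdx (kk m + kk m) → Bool) → Bool) (dE : ℕ) (rE : Polynomial ℕ)
    (hE : ∀ (m : ℕ) (c : (Fin m → Bool) → CertIdx (kk m + kk m) → Bool) (dc sc : ℕ),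
      (∀ k, ACRealOver (accBasis 2) (fun w => c w k) dc sc) →
        ACRealOver (accBasis 2) (fun w => E m w (c w)) (dE + dc) (rE.eval m * (sc + 1))) :
    ¬ ∀ (m : ℕ) (w : Fin m → Bool) (c : CertIdx (kk m + kk m) → Bool),
      c ∈ validCerts (fun y => cubeMM (m + 1) (frameA w y)) → E m w c = decide (GateFn.numOnes w % 3 = 0) := by
  intro h
  apply not_acRealOver_mod3
  refine ⟨dE + 1, rE * 2, fun m => ?_⟩
  have h1 := hE m (fun _ => easyCert m) 1 1 fun k => acRealOver_of_isLit (IsLit.const _)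
  refine (h1.mono le_rfl (le_of_eq ?_)).congr fun w => h m w _ (easyCert_mem_validCerts w)
  simp only [Polynomial.eval_mul, Polynomial.eval_ofNat]; rfl

end Easy

end Summit.QuantumAdvantage.QuantumAdvantage.Theorems.FlatDial
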